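import Summits.AtomisticToContinuum.BoseEinsteinCondensation.Theorems.PeriodicIRBound.Negative.GroundOccupation
import Summits.AtomisticToContinuum.BoseEinsteinCondensation.Theorems.PeriodicIRBound.Negative.LoadBearing
import Literature.MathematicalPhysics.QuantumManyBody.PeriodicBoseGasMomentumSector
import Literature.MathematicalPhysics.QuantumManyBody.BoseGasDirichletWall
import Literature.MathematicalPhysics.QuantumManyBody.PeriodicBoseGasThm31

/-!
# Crux `PeriodicIRBound` (stmt-AtomisticToContinuum-3972) — zero-momentum gap instances and a.e.-zero potentials

Negative-side support file I of the deep-refute pass on the line `linear-ph-floor-wagner`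
(`Cruxes/PeriodicIRBound/Lines/linear-ph-floor-wagner.lean`; refuter-drefute-stmt-AtomisticToContinuum-3972-0,
2026-08-16). The line's `stub_transfer` takes the fixed-`(N,L)` zero-momentum gap
`ZeroMomentumGapFor v : ∀ N L, 0 < L → ∀ q ≠ 0, E₀^per(N,L) < E^per_N(q;L)` (= the body of stmt-11845 per
potential) and concludes the crux for `v` in γ-form (`GroundIRBoundFor v`, over the landed
`GroundIRBoundWith`); its `∫v = 0` branch is "the a.e.-free gas". Everything is stated over tree primitives,
so the theorems are LITERAL instances of the skeleton's (non-importable) definitions.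

Findings (all `[folklore]`, sorry-free, axioms `propext`/`Classical.choice`/`Quot.sound`):

* `momentumSectorEnergy_zero_particles` — DEGENERATE CASE `N = 0`: every non-zero momentum sector of the
  zero-particle system is empty (`E^per_0(q;L) = ⊤`; the Bloch condition `c = e^{iq·s}c` on a non-zero
  constant forces `q = 0`). stmt-11845's "N = 0 holds because the Bloch-q class is empty", as a lemma.
* `zeroMomentumGap_free`, `zeroMomentumGapFor_free` — `ZeroMomentumGapFor 0` HOLDS (c.o.m. bound
  `E_N(q) ≥ |q|²/N > 0 = E₀` for `N ≥ 1`, empty sector for `N = 0`).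
* `not_zeroMomentumGapFor_hardCore` — MUTATION: the same `∀ L` gap statement is FALSE for the admissible
  HARD CORE (jamming: nine unit cores on the unit torus, `E₀ = E_N(q) = ⊤`, `⊤ < ⊤` fails). The guard
  `∫ v ≠ ⊤` of stmt-11845 is load-bearing; the hard-core zero-momentum gap needed by the line's
  `stub_hardCore` must be a LOW-DENSITY statement.
* `periodicEnergy_eq_zero_of_lintegral_eq_zero` (+ ground-state / sector / occupation versions) — an
  a.e.-ZERO profile (`∫ v(|x|)dx = 0`) IS the free gas at the level of the quadratic form (slice
  integration: `v^per(xᵢ - xⱼ) = 0` for a.e. configuration of the cell). Hence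
  `zeroMomentumGapFor_of_lintegral_eq_zero` and `groundIRBoundFor_of_lintegral_eq_zero`: the `∫v = 0`
  branch of `stub_transfer` holds outright (every `C > 0`, from the landed `irBoundWith_zero`).

Companion file II (`LinearFloorGuards.lean`): the free Bijl–Feynman bound and the failure of the linear
particle–hole floor for (a.e.-)free potentials.
-/

noncomputable section

open scoped ENNReal
open Filter MeasureTheory

namespace Summit.AtomisticToContinuum.BoseEinsteinCondensation.Theorems.PeriodicIRBound.Negative

open Literature.MathematicalPhysics.QuantumManyBody.BoseGas
open Summit.AtomisticToContinuum.BoseEinsteinCondensation.Theorems.GaussianDominationCan.Negative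
  (periodicInteraction_zero)
open Summit.AtomisticToContinuum.BoseEinsteinCondensation.Theorems.CorrectorClosure.Negative
  (hardCore isRepulsiveFiniteRange_hardCore periodicEnergy_hardCore_eq_top)

/-! ## §1 The zero-momentum gap hypothesis: degenerate case, free instance, hard-core mutation -/

/-- **`N = 0`: non-zero momentum sectors are empty.** A zero-particle "wave function" is a constant
`c ≠ 0` on the one-point configuration space; the Bloch condition `c = e^{iq·s} c` for all `s` forces
`q = 0`. Hence `E^per_0(q;L) = ⊤` for `q ≠ 0` (any `L`, any `v`). [folklore] -/
theorem momentumSectorEnergy_zero_particles (v : ℝ → ℝ≥0∞) (L : ℝ) {q : Space} (hq : q ≠ 0) :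
    momentumSectorEnergy v 0 L q = ⊤ := by
  refine iInf_eq_top.2 fun Ψ => iInf_eq_top.2 fun hΨ => ?_
  exfalso
  obtain ⟨X, hX⟩ := Ψ.exists_ne_zero
  -- a coordinate where `q` is non-zero
  have hqa : ∃ a : Fin 3, q a ≠ 0 := by
    by_contra h
    push Not at h
    exact hq (by ext a; simpa using h a)
  obtain ⟨a, ha⟩ := hqa
  -- translate by `s = (π / q a) eₐ`: the phase is `e^{iπ} = -1`
  have h1 := hΨ (EuclideanSpace.single a (Real.pi / q a)) X
  have hXs : (fun i : Fin 0 => X i + EuclideanSpace.single a (Real.pi / q a)) = X :=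
    funext fun i => Fin.elim0 i
  have hsum : (∑ j, q j * (EuclideanSpace.single a (Real.pi / q a) : Space) j) = Real.pi := by
    simp only [PiLp.single_apply, mul_ite, mul_zero, Finset.sum_ite_eq',
      Finset.mem_univ, if_true]
    field_simp
  rw [hXs, hsum, mul_comm Complex.I, Complex.exp_pi_mul_I] at h1
  have : Ψ.ψ X = 0 := by linear_combination h1 / 2
  exact hX this

/-- **The free gas has the fixed-`(N,L)` zero-momentum gap** (`ZeroMomentumGapFor 0` of the skeleton):
`E₀^per(v≡0, N, L) = 0 < E^per_N(q;L)` for every `N`, every `L > 0` and every `q ≠ 0` — for `N ≥ 1`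
by the centre-of-mass bound `E_N(q) ≥ |q|²/N > 0`, for `N = 0` because the sector is empty.
[folklore] -/
theorem zeroMomentumGap_free (N : ℕ) {L : ℝ} (hL : 0 < L) {q : Space} (hq : q ≠ 0) :
    periodicGroundStateEnergy (0 : ℝ → ℝ≥0∞) N L < momentumSectorEnergy 0 N L q := by
  rw [periodicGroundStateEnergy_zero_eq_zero N hL]
  rcases Nat.eq_zero_or_pos N with rfl | hN
  · rw [momentumSectorEnergy_zero_particles 0 L hq]
    exact ENNReal.zero_lt_top
  · refine lt_of_lt_of_le ?_ (ofReal_norm_sq_div_le_momentumSectorEnergy 0 N L q)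
    rw [ENNReal.ofReal_pos]
    have hq' : 0 < ‖q‖ := norm_pos_iff.2 hq
    have hN' : (0 : ℝ) < N := by exact_mod_cast hN
    positivity

/-- The skeleton's `ZeroMomentumGapFor 0`, verbatim shape. [folklore] -/
theorem zeroMomentumGapFor_free :
    ∀ (N : ℕ) (L : ℝ), 0 < L → ∀ q : Space, q ≠ 0 →
      periodicGroundStateEnergy (0 : ℝ → ℝ≥0∞) N L < momentumSectorEnergy 0 N L q :=
  fun N _ hL _ hq => zeroMomentumGap_free N hL hq

/-- **Jamming kills the `∀ L` gap for hard cores** (`¬ ZeroMomentumGapFor hardCore`): on the unit torus,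
nine unit hard cores cannot avoid each other (`periodicEnergy_hardCore_eq_top` with `m = 2`,
`2³ < 9`), so `E₀^per(9, 1) = ⊤` and `E₀ < E_9(q)` fails. The integrability guard `∫v ≠ ⊤` of
stmt-11845 is load-bearing; a hard-core zero-momentum gap must carry a density restriction. [folklore] -/
theorem not_zeroMomentumGapFor_hardCore :
    ¬ ∀ (N : ℕ) (L : ℝ), 0 < L → ∀ q : Space, q ≠ 0 →
      periodicGroundStateEnergy hardCore N L < momentumSectorEnergy hardCore N L q := by
  intro h
  have hq : (EuclideanSpace.single (0 : Fin 3) (1 : ℝ) : Space) ≠ 0 := by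
    intro h0
    have := congrArg (fun x : Space => x 0) h0
    simp at this
  have h9 := h 9 1 one_pos _ hq
  have hE0 : periodicGroundStateEnergy hardCore 9 1 = ⊤ :=
    iInf_eq_top.2 fun Ψ => periodicEnergy_hardCore_eq_top (m := 2) one_pos (by norm_num)
      (by norm_num) Ψ
  rw [hE0] at h9
  exact not_top_lt h9

/-! ## §2 a.e.-zero potentials are the free gas: the `∫v = 0` branch of `stub_transfer` -/

section AeZero

variable {N : ℕ} {L : ℝ}

/-- The periodised potential of a measurable profile is measurable. [folklore] -/
private theorem measurable_periodizedPotential_lfg {v : ℝ → ℝ≥0∞} (hv : Measurable v) (L : ℝ) :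
    Measurable (periodizedPotential v L) := by
  show Measurable fun x => ∑' n : Fin 3 → ℤ, v ‖x - latticeVec L n‖
  exact Measurable.tsum fun n => hv.comp (measurable_id.sub_const _).norm

/-- **`∫ v(|x|)dx = 0` ⇒ `∫ v^per(x - c) dx = 0`** for every shift `c` (translation invariance, term by
term in the lattice sum). [folklore] -/
theorem lintegral_periodizedPotential_sub_eq_zero {v : ℝ → ℝ≥0∞} (hv : Measurable v)
    (h0 : (∫⁻ x : Space, v ‖x‖) = 0) (L : ℝ) (c : Space) :
    (∫⁻ x : Space, periodizedPotential v L (x - c)) = 0 := by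
  have hmeas : ∀ n : Fin 3 → ℤ, Measurable fun x : Space => v ‖x - c - latticeVec L n‖ :=
    fun n => hv.comp ((measurable_id.sub_const _).sub_const _).norm
  have hterm : ∀ n : Fin 3 → ℤ, (∫⁻ x : Space, v ‖x - c - latticeVec L n‖) = 0 := by
    intro n
    have h := lintegral_sub_right_eq_self (μ := (volume : Measure Space))
      (fun y : Space => v ‖y‖) (c + latticeVec L n)
    rw [h0] at h
    rw [← h]
    refine lintegral_congr fun x => ?_
    rw [sub_sub]
  unfold periodizedPotential
  rw [lintegral_tsum fun n => (hmeas n).aemeasurable]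
  simp [hterm]

/-- **a.e.-zero potentials do not interact**: if `∫ v(|x|) dx = 0` then for every pair `i ≠ j` the
periodised pair potential `v^per(xᵢ - xⱼ)` vanishes for a.e. configuration of the cell (slice
integration in `xᵢ`). [folklore] -/
theorem lintegral_cellN_periodizedPotential_pair_eq_zero {v : ℝ → ℝ≥0∞} (hv : Measurable v)
    (h0 : (∫⁻ x : Space, v ‖x‖) = 0) (hL : 0 < L) {i j : Fin N} (hij : i ≠ j) :
    (∫⁻ X in cellN N L, periodizedPotential v L (X i - X j)) = 0 := by
  have hP := measurable_periodizedPotential_lfg hv L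
  have hH : Measurable fun X : Config N => periodizedPotential v L (X i - X j) :=
    hP.comp ((measurable_pi_apply i).sub (measurable_pi_apply j))
  have hslice := lintegral_cellN_lintegral_update (L := L) i hH
  -- the inner slice integral vanishes for every `X`
  have hinner : ∀ X : Config N,
      (∫⁻ x in cell L, periodizedPotential v L (Function.update X i x i - Function.update X i x j)) = 0 := by
    intro X
    simp only [Function.update_self, Function.update_of_ne hij.symm]
    refine le_antisymm ?_ bot_le
    calc (∫⁻ x in cell L, periodizedPotential v L (x - X j))
        ≤ ∫⁻ x, periodizedPotential v L (x - X j) := lintegral_mono' Measure.restrict_le_self le_rfl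
      _ = 0 := lintegral_periodizedPotential_sub_eq_zero hv h0 L (X j)
  simp only [hinner, lintegral_zero] at hslice
  have hL3 : ENNReal.ofReal L ^ 3 ≠ 0 := pow_ne_zero _ ((ENNReal.ofReal_pos.2 hL).ne')
  exact (mul_eq_zero.1 hslice.symm).resolve_left hL3

/-- **a.e.-zero potentials are the free gas at the level of the quadratic form**: if `∫ v(|x|)dx = 0`
then `⟨Ψ, H_v Ψ⟩ = ⟨Ψ, -ΔΨ⟩` for every periodic trial state (`L > 0`). [folklore] -/
theorem periodicEnergy_eq_zero_of_lintegral_eq_zero {v : ℝ → ℝ≥0∞} (hv : Measurable v)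
    (h0 : (∫⁻ x : Space, v ‖x‖) = 0) (hL : 0 < L) (Ψ : PeriodicTrialState N L) :
    periodicEnergy v Ψ = periodicEnergy 0 Ψ := by
  have hP := measurable_periodizedPotential_lfg hv L
  -- the interaction vanishes a.e. on the cell
  have hae : ∀ᵐ X ∂(volume.restrict (cellN N L)), periodicInteraction v L X = 0 := by
    have hpair : ∀ i j : Fin N, i ≠ j →
        ∀ᵐ X ∂(volume.restrict (cellN N L)), periodizedPotential v L (X i - X j) = 0 := by
      intro i j hij
      have hH : Measurable fun X : Config N => periodizedPotential v L (X i - X j) :=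
        hP.comp ((measurable_pi_apply i).sub (measurable_pi_apply j))
      exact (lintegral_eq_zero_iff hH).1 (lintegral_cellN_periodizedPotential_pair_eq_zero hv h0 hL hij)
    have hall : ∀ᵐ X ∂(volume.restrict (cellN N L)), ∀ i j : Fin N, i ≠ j →
        periodizedPotential v L (X i - X j) = 0 :=
      ae_all_iff.2 fun i => ae_all_iff.2 fun j => by
        by_cases hij : i = j
        · exact Eventually.of_forall fun _ h => (h hij).elim
        · exact (hpair i j hij).mono fun X hX _ => hX
    filter_upwards [hall] with X hX
    unfold periodicInteraction
    refine Finset.sum_eq_zero fun i _ => Finset.sum_eq_zero fun j hj => ?_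
    exact hX i j (ne_of_lt (Finset.mem_filter.1 hj).2)
  unfold periodicEnergy
  refine lintegral_congr_ae ?_
  filter_upwards [hae] with X hX
  rw [hX, Theorems.GaussianDominationCan.Negative.periodicInteraction_zero]

/-- Hence the ground-state and momentum-sector energies of an a.e.-zero potential are the free ones. [folklore] -/
theorem periodicGroundStateEnergy_eq_zero_of_lintegral_eq_zero {v : ℝ → ℝ≥0∞} (hv : Measurable v)
    (h0 : (∫⁻ x : Space, v ‖x‖) = 0) (hL : 0 < L) (N : ℕ) :
    periodicGroundStateEnergy v N L = periodicGroundStateEnergy 0 N L :=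
  iInf_congr fun Ψ => periodicEnergy_eq_zero_of_lintegral_eq_zero hv h0 hL Ψ

/-- Momentum-sector version. [folklore] -/
theorem momentumSectorEnergy_eq_zero_of_lintegral_eq_zero {v : ℝ → ℝ≥0∞} (hv : Measurable v)
    (h0 : (∫⁻ x : Space, v ‖x‖) = 0) (hL : 0 < L) (N : ℕ) (k : Space) :
    momentumSectorEnergy v N L k = momentumSectorEnergy 0 N L k :=
  iInf_congr fun Ψ => iInf_congr fun _ => periodicEnergy_eq_zero_of_lintegral_eq_zero hv h0 hL Ψ

/-- Ground-state occupations too (the line's `GroundIRBoundFor v` for such `v` IS `GroundIRBoundFor 0`). [folklore] -/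
theorem groundOccupation_eq_zero_of_lintegral_eq_zero {v : ℝ → ℝ≥0∞} (hv : Measurable v)
    (h0 : (∫⁻ x : Space, v ‖x‖) = 0) (hL : 0 < L) (N : ℕ) (k : Fin 3 → ℤ) :
    groundOccupation v N L k = groundOccupation 0 N L k := by
  unfold groundOccupation
  simp_rw [periodicEnergy_eq_zero_of_lintegral_eq_zero hv h0 hL,
    periodicGroundStateEnergy_eq_zero_of_lintegral_eq_zero hv h0 hL]


/-- **The `∫v = 0` branch of the line's `stub_transfer`, closed**: for an a.e.-zero profile the
ground-state occupations obey the crux's bound with EVERY `C > 0` (free-gas kinetic Markov bound,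
`irBoundWith_zero`, transported by `groundOccupation_eq_zero_of_lintegral_eq_zero`). [folklore] -/
theorem groundIRBoundWith_of_lintegral_eq_zero {v : ℝ → ℝ≥0∞} (hv : Measurable v)
    (h0 : (∫⁻ x : Space, v ‖x‖) = 0) {κ ρ₀ C : ℝ} (hC : 0 < C) : GroundIRBoundWith v κ ρ₀ C := by
  intro ρ hρ hρρ₀
  filter_upwards [groundIRBoundWith_of (irBoundWith_zero (κ := κ) (ρ₀ := ρ₀) hC) ρ hρ hρρ₀,
    eventually_gt_atTop 0] with N hN hNpos k hk
  rw [groundOccupation_eq_zero_of_lintegral_eq_zero hv h0 (sideLength_pos_of_pos hρ hNpos)]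
  exact hN k hk

/-- `GroundIRBoundFor v` of the skeleton (body verbatim) for every a.e.-zero profile `v`. [folklore] -/
theorem groundIRBoundFor_of_lintegral_eq_zero {v : ℝ → ℝ≥0∞} (hv : Measurable v)
    (h0 : (∫⁻ x : Space, v ‖x‖) = 0) :
    ∀ κ : ℝ, 0 < κ → ∃ ρ₀ : ℝ, 0 < ρ₀ ∧ ∃ C : ℝ, 0 < C ∧ GroundIRBoundWith v κ ρ₀ C :=
  fun _ _ => ⟨1, one_pos, 1, one_pos, groundIRBoundWith_of_lintegral_eq_zero hv h0 one_pos⟩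

/-- `ZeroMomentumGapFor v` (body verbatim) for every a.e.-zero measurable profile: both sides are the
free ones (`zeroMomentumGap_free`). [folklore] -/
theorem zeroMomentumGapFor_of_lintegral_eq_zero {v : ℝ → ℝ≥0∞} (hv : Measurable v)
    (h0 : (∫⁻ x : Space, v ‖x‖) = 0) :
    ∀ (N : ℕ) (L : ℝ), 0 < L → ∀ q : Space, q ≠ 0 →
      periodicGroundStateEnergy v N L < momentumSectorEnergy v N L q := by
  intro N L hL q hq
  rw [periodicGroundStateEnergy_eq_zero_of_lintegral_eq_zero hv h0 hL,
    momentumSectorEnergy_eq_zero_of_lintegral_eq_zero hv h0 hL]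
  exact zeroMomentumGap_free N hL hq

end AeZero

end Summit.AtomisticToContinuum.BoseEinsteinCondensation.Theorems.PeriodicIRBound.Negative

end
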